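import Literature.AnabelianGeometry.EtaleTheta.FrobenioidKummerOut
import Literature.AnabelianGeometry.EtaleTheta.ThetaEnvOfSetting

/-!
# [EtTh] §5 ↔ §3: the CONSTANTS OF `B_N` READ IN `ℚ̄_p` — one predicate bundling the base-field dictionary of the tempered Frobenioid (Def. 3.6 (iii)/(iv) p. 304, Lemma 5.8 p. 331 / PDF pp. 78, 105)

Mochizuki, *The étale theta function and its Frobenioid-theoretic manifestations*, Publ. RIMS **45** (2009).
Def. 3.6 (iv) p.304 (PDF p.78): the *base-field-theoretic hull* `C^{bs-fld} ⊆ C` of the tempered Frobenioid — "the subcategory … determined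
by the [constant] monoids `O^▷(−) ∩ K_A^×`", a `p`-adic Frobenioid whose units at an object `A` are the units of the base field of `A`;
Def. 3.6 (iii) (the constants `K`); Lemma 5.8 p.331 (PDF p.105): "write `(K^×)^{1/N} ⊆ O^×(B_N^birat)` for the subgroup of elements whose
`N`-th power lies in the image of the natural inclusion `K^× ↪ O^×(B_N^birat)` … the set of elements of `O^×(B_N)` on which `Π^tp_Y`
[i.e., `G_K`, via the natural surjection `Π^tp_Y ↠ G_K`] acts via multiplication by an element of `μ_N(B_N)`"; §5 p.322 (PDF p.96):
"geometrically connected over the field `K = K̈`"; Def. 5.4 p.327 (PDF p.101) (`B_N` is `(l,N)`-theta-saturated).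
[cite: MochizukiEtTh2009, Def 3.6 (iv) p.304 (PDF p.78); Lem 5.8 p.331 (PDF p.105)]

abc-iut cell, layer L2, seat abc-iut-L2-t11 (gen 4); abc-iut-L2-lead (gen 4) ruling R229 «CONSTANTS-DICTIONARY BUNDLE»: ONE DEFS-FREEZE
class (c) Prop-valued PREDICATE over EXISTING fields (no data field, no instance, no notation, no new zero-argument `Prop` fact),
packaging the junction field family of this seat's census memo `HOME/staging/L2/L2-t11/VNEXT-CONSTANTS-DICTIONARY.md` (v1.1) so that
every consumer of the [EtTh] §5 ↔ §2 arithmetic dictionary takes ONE binder.  The DATA are PARAMETERS: a subgroup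
`Cst ≤ O^×(B_N^birat)` ("the constants of `B_N`") and a reading `ν̃ : Cst →* ℚ̄_p^×` (an embedding of the base field of `B_N` into
`ℚ̄_p` over `K`, restricted to units); the comparison is with abc-iut-L2-t8's §1/§2 model `T := Cu.thetaEnvData μ hC hS` of the setting at
level `𝔉.N` along `ι : Π^tp_X̲ ≃ Π^tp_X̲̲` and a cyclotome identification `m : μ_N(B_N) ≃* μ_N(ℚ̄_p)`.  LAW FIELDS (each quotes print):
`units_mem` (Prop. 3.4 (ii)/Def. 3.3: an element with trivial divisor is constant — `O^×(B_N) ⊆ Cst`), `constEmb_mem` (`K^× ⊆ Cst`),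
`kxRootN_le` (`(K^×)^{1/N} ⊆ Cst`), `act_mem` (`Aut_C(B_N)` preserves constants), `injective`, `equivariant` ("`Π^tp_Y` [i.e., `G_K` …]
acts": the birational action of `s^⊓-gp_N(ρ(y))` on constants is the Galois action of `aug(ι y) ∈ G_K ≤ Gal(ℚ̄_p/ℚ_p)`), `mu_compat`
(the reading extends `m` on `μ_N(B_N)`), `constEmb_read` / `reaches_K` (the constants `K` of `𝔉` read onto `K ⊆ ℚ̄_p`), `roots_of_K`
(`B_N`'s constants contain an `N`-th root of every element of `K` — theta-saturation, Def. 5.4).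
CONSUMERS (proof-only knit `Discharge/Sec5OfConstantsDictionary.lean`, this seat — this file is STATEMENT-ONLY): `hgc` (GAP G-L2t4-4,
p438336), `hsurj` (p438929),
`hgeom`/`hKumC` (G-L2t11-1/2, p424113), F-1306 at the junction (abc-iut-f-125 p437488; `tf`-intrinsic form p438316), Lemma 5.9 (iv) /
[IUTchII] Prop. 1.2 (ii) `hM` / Thm. 5.10 (iii) at `DK := kummerOut` (p437577).
HONEST FRAMING: a hypothesis predicate; no instance of it is constructed here (the tempered Frobenioid `tf` of an actual curve is not in the
tree); nothing of [EtTh] is asserted; typed ≠ proved; no side is taken on anything downstream ([IUTchIII] Cor. 3.12).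
-/

noncomputable section

namespace Literature.AnabelianGeometry.EtaleTheta

open CategoryTheory Literature.AnabelianGeometry.SemiGraphs

universe w u u' v'

namespace ThetaFrobenioid

variable {C₀ : Type u} [Category.{0} C₀] {D₀ : Type u'} [Category.{v'} D₀] {𝔉 : ThetaFrobenioid.{w} C₀ D₀}

namespace BiratAutAction

/-- **The constants of `B_N` read in `ℚ̄_p`** ([EtTh] Def. 3.6 (iv) "`C^{bs-fld}`", Lemma 5.8): a predicate on a subgroup
`Cst ≤ O^×(B_N^birat)` (the constants) and a reading `ν̃ : Cst →* ℚ̄_p^×`, relative to the natural action `α` of `Aut_C(B_N)` on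
`O^×(B_N^birat)`, abc-iut-L2-t8's model `Cu.thetaEnvData μ hC hS` of the setting (at level `𝔉.N`, along `ι`) and the cyclotome
identification `m`.  Laws: the units `O^×(B_N)`, the constants `K^×` and their `N`-th roots `(K^×)^{1/N}` are constants; `Aut_C(B_N)`
preserves constants; the reading is injective, `G_K`-equivariant ("`Π^tp_Y` [i.e., `G_K`, via the natural surjection `Π^tp_Y ↠ G_K`]
acts", "geometrically connected over `K`"), extends `m` on `μ_N(B_N)`, reads the constants `K` of `𝔉` onto `K ⊆ ℚ̄_p`, and `B_N`'s
constants contain the `N`-th roots of `K` (Def. 5.4: `B_N` is `(l,N)`-theta-saturated).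
[cite: MochizukiEtTh2009, Def 3.6 (iv) p.304 (PDF p.78); Lem 5.8 p.331 (PDF p.105)] -/
structure ConstantsDictionary (α : 𝔉.BiratAutAction) {p : ℕ} [Fact p.Prime] {D : ThetaSetting p} {E : D.EtaleThetaData}
    {l : ℕ} (Cu : E.DoubleUnderline l) (μ : D.CyclotomeMod l 𝔉.N) (hC : D.Compat) (hS : D.Sec2Hyps)
    (ι : 𝔉.PiX ≃ₜ* (Cu.thetaEnvData μ hC hS).PiX) (m : 𝔉.muTorsion 𝔉.BN 𝔉.N ≃* (Cu.thetaEnvData μ hC hS).mu)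
    (Cst : Subgroup (𝔉.biratUnits 𝔉.BN)) (ν' : Cst →* (PadicAlgCl p)ˣ) : Prop where
  /-- `O^×(B_N) ⊆ Cst`: a unit (an element with trivial divisor) is a constant (Prop. 3.4 (ii); Def. 3.3 (iii)). -/
  units_mem : ∀ u : 𝔉.units 𝔉.BN, 𝔉.unitsToBirat 𝔉.BN u ∈ Cst
  /-- `K^× ⊆ Cst`: "the natural inclusion `K^× ↪ O^×(B_N^birat)`" lands in the constants (Def. 3.6 (iii), Lemma 5.8). -/
  constEmb_mem : ∀ k : 𝔉.Kˣ, 𝔉.constEmb k ∈ Cst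
  /-- `(K^×)^{1/N} ⊆ Cst`: an `N`-th root of a constant is a constant (the base field is relatively algebraically closed in the
  function field; Lemma 5.8 "`(K^×)^{1/N} ⊆ O^×(B_N^birat)`"). -/
  kxRootN_le : 𝔉.KxRootN ≤ Cst
  /-- `Aut_C(B_N)` preserves the constants (functoriality of `C → C^{bs-fld}`, Def. 3.6 (iv)). -/
  act_mem : ∀ (e : Aut 𝔉.BN) (x : 𝔉.biratUnits 𝔉.BN), x ∈ Cst → α.act e x ∈ Cst
  /-- the reading `ν̃` is injective (an embedding of the base field of `B_N` into `ℚ̄_p`). -/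
  injective : Function.Injective ν'
  /-- `G_K`-equivariance: "`Π^tp_Y` [i.e., `G_K`, via the natural surjection `Π^tp_Y ↠ G_K`] acts" — the birational action of
  `s^⊓-gp_N(ρ(y))`, `y ∈ Π^tp_X̲`, on a constant, read in `ℚ̄_p`, is the Galois action of `aug(ι y) ∈ G_K ≤ Gal(ℚ̄_p/ℚ_p)`
  (Lemma 5.8 proof; "geometrically connected over `K`", §5 p.322). -/
  equivariant : ∀ (y : 𝔉.PiX) (x : Cst),
    ν' ⟨α.act (𝔉.sgpCap (𝔉.ρ y)) x, act_mem _ _ x.2⟩ = (((Cu.thetaEnvData μ hC hS).aug (ι y) : D.GK) : GQp p) • ν' x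
  /-- the reading extends the cyclotome identification `m : μ_N(B_N) ≃* μ_N(ℚ̄_p)` ("`μ_N(B_N) ⊆ (K^×)^{1/N}`", Lemma 5.8). -/
  mu_compat : ∀ u : 𝔉.muTorsion 𝔉.BN 𝔉.N,
    ν' ⟨𝔉.muToBirat u, (units_mem ⟨(u : Aut 𝔉.BN), 𝔉.muTorsion_le_units _ _ u.2⟩ : 𝔉.muToBirat u ∈ Cst)⟩ =
      ((m u : MuN p 𝔉.N) : (PadicAlgCl p)ˣ)
  /-- the constants `K` of `𝔉` read INTO `K ⊆ ℚ̄_p` (Def. 3.6 (iii): the constant field is `K`). -/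
  constEmb_read : ∀ k : 𝔉.Kˣ, ((ν' ⟨𝔉.constEmb k, constEmb_mem k⟩ : (PadicAlgCl p)ˣ) : PadicAlgCl p) ∈ D.K
  /-- … and ONTO `K^×` (every element of `K^×` is the reading of a constant of `𝔉`). -/
  reaches_K : ∀ z : (D.K)ˣ, ∃ k : 𝔉.Kˣ,
    ((ν' ⟨𝔉.constEmb k, constEmb_mem k⟩ : (PadicAlgCl p)ˣ) : PadicAlgCl p) = algebraMap D.K (PadicAlgCl p) (z : D.K)
  /-- `B_N`'s constants contain an `N`-th root of every element of `K^×` (Def. 5.4: `B_N` is `(l,N)`-theta-saturated; its base field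
  contains `K(k^{1/N} : k ∈ K)` — Lemma 5.8 "`(K^×)^{1/N}/μ_N(B_N) ⥲ K^×`"). -/
  roots_of_K : ∀ y : (D.K)ˣ, ∃ f : 𝔉.KxRootN,
    ((ν' ⟨(f : 𝔉.biratUnits 𝔉.BN), kxRootN_le f.2⟩ : (PadicAlgCl p)ˣ) : PadicAlgCl p) ^ (𝔉.N : ℕ) =
      algebraMap D.K (PadicAlgCl p) (y : D.K)

end BiratAutAction

end ThetaFrobenioid

end Literature.AnabelianGeometry.EtaleTheta

end
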